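import Literature.AlgebraicGeometry.Motives.ClosedSubvarietyOfPoint
import Literature.AlgebraicGeometry.Motives.CyclesPushforwardFacts
import HarnessLib

/-!
# Residue degrees versus degrees of function fields of point closures

For a quasi-compact morphism of schemes `π : X' → X` and a closed subvariety `Ṽ ⊆ X'`
(e.g. `Ṽ = closure {z'}`, `Motives/ClosedSubvarietyOfPoint`) with image subvariety
`W = π(Ṽ) ⊆ X` (`ClosedSubvariety.image`, `Motives/CyclesPushforwardFacts`) and induced dominant
`h : Ṽ → W` (`ClosedSubvariety.toImage`), Mathlib's residue degree `[κ(z') : κ(π z')]` of `π` at the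
generic point `z'` of `Ṽ` (`Scheme.Hom.residueDegree`, the weight of proper push-forward of
cycles, `AlgebraicCycle.map`) equals the degree `[R(Ṽ) : R(W)]` of the function field extension
`h^♯ : R(W) → R(Ṽ)` (`RatFn.functionFieldMap`), the degree `deg(Ṽ/W)` of Fulton, *Intersection
Theory*, §1.4 ("`deg(V/W) = [R(V) : R(W)]`" defining `f_*[V] = deg(V/W)[W]`) — because the residue
field of a scheme at a point is the function field of the reduced closure of the point:

* `ClosedSubvariety.ker_stalkMap_genericPoint`, `ClosedSubvariety.residueFieldEquiv` —
  `κ(ι ξ) ≅ R(V)` for a closed subvariety `ι : V ↪ Y` with generic point `ξ`;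
* `ClosedSubvariety.residueDegree_eq_finrank_of_fac` — **`[κ(ξ̃) : κ(π ξ̃)] = [R(Ṽ) : R(W)]`** for any
  factorisation `Ṽ → W ↪ X` of `Ṽ ↪ X' → X` with `Ṽ → W` dominant (e.g. `W = closure {π ξ̃}` with its
  reduced structure); `ClosedSubvariety.residueDegree_eq_finrank_functionField` — the case `W = π(Ṽ)`.

This identifies the two degrees appearing in Fulton's projection formula (Prop. 2.3 (c):
`f_*[f^*D] = deg(X'/X)[D]`, `Motives/CartierDivisorProjectionFormula`, stated with
`[R(X') : R(X)]`) and in the push-forward of cycles (residue degrees).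

## References

* W. Fulton, *Intersection Theory*, 2nd ed., Springer 1998, §1.4 (p. 11). [Fulton1998]
-/

noncomputable section

universe u

open CategoryTheory AlgebraicGeometry Order Topology IsLocalRing

namespace Literature.AlgebraicGeometry.Motives

namespace ClosedSubvariety

open RatFn

/-! ### The residue field at the generic point of a closed subvariety is its function field -/

section ResidueField

variable {Y : Scheme.{u}} (V : ClosedSubvariety Y)

/-- For a closed subvariety `ι : V ↪ Y` with generic point `ξ`, the stalk map
`𝒪_{Y, ι ξ} → 𝒪_{V, ξ} = R(V)` is a surjection of a local ring onto a field, so its kernel is the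
maximal ideal. [folklore] -/
theorem ker_stalkMap_genericPoint :
    RingHom.ker (V.ι.stalkMap (_root_.genericPoint V.carrier)).hom =
      maximalIdeal (Y.presheaf.stalk (V.ι (_root_.genericPoint V.carrier))) :=
  eq_maximalIdeal (RingHom.ker_isMaximal_of_surjective (K := V.carrier.functionField) _
    (V.ι.stalkMap_surjective _))

/-- **`κ(ι ξ) ≅ R(V)`**: the residue field of `Y` at the generic point of the closed subvariety `V`
is the function field of `V`, through the (local, surjective) stalk map of `ι`. [folklore] -/
def residueFieldEquiv :
    ResidueField (Y.presheaf.stalk (V.ι (_root_.genericPoint V.carrier))) ≃+*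
      V.carrier.functionField :=
  RingEquiv.ofBijective (ResidueField.lift (V.ι.stalkMap (_root_.genericPoint V.carrier)).hom)
    ⟨(ResidueField.lift _).injective, fun t => by
      obtain ⟨s, rfl⟩ := V.ι.stalkMap_surjective _ t
      exact ⟨residue _ s, rfl⟩⟩

/-- `residueFieldEquiv` on the residue class of `s ∈ 𝒪_{Y, ι ξ}` is `ι^♯_ξ(s)`. [folklore] -/
theorem residueFieldEquiv_residue (s : Y.presheaf.stalk (V.ι (_root_.genericPoint V.carrier))) :
    V.residueFieldEquiv (residue _ s) = (V.ι.stalkMap (_root_.genericPoint V.carrier)).hom s :=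
  rfl

end ResidueField

/-! ### `[κ(ξ̃) : κ(π ξ̃)] = [R(Ṽ) : R(W)]` -/

section DegreeFac

variable {X' X : Scheme.{u}} (π : X' ⟶ X) (V : ClosedSubvariety X')

/-- If `Ṽ ↪ X' → X` factors as `Ṽ → W ↪ X` through a closed subvariety `W` by a dominant `h`, then
`π` maps the generic point of `Ṽ` to the generic point of `W` (in `X`). [folklore] -/
theorem apply_ι_genericPoint_eq_of_fac (W : ClosedSubvariety X) (h : V.carrier ⟶ W.carrier)
    [IsDominant h] (fac : h ≫ W.ι = V.ι ≫ π) :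
    π (V.ι (_root_.genericPoint V.carrier)) = W.ι (_root_.genericPoint W.carrier) := by
  rw [← Scheme.Hom.comp_apply, ← genericPoint_eq_of_isDominant h, ← Scheme.Hom.comp_apply, fac]

/-- **The residue degree of `π` at the generic point of a closed subvariety `Ṽ ⊆ X'` is the degree
`[R(Ṽ) : R(W)]` of the function field extension of any dominant `h : Ṽ → W` onto a closed
subvariety `W ⊆ X` factoring `Ṽ ↪ X' → X`** (Fulton §1.4: `deg(V/W) = [R(V) : R(W)]`, `W = f(V)`;
with Mathlib's junk value `0` on both sides in the infinite case). [cite: Fulton1998, §1.4 (p. 11)] -/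
theorem residueDegree_eq_finrank_of_fac (W : ClosedSubvariety X) (h : V.carrier ⟶ W.carrier)
    [IsDominant h] (fac : h ≫ W.ι = V.ι ≫ π) :
    π.residueDegree (V.ι (_root_.genericPoint V.carrier)) =
      (letI := (functionFieldMap h).toAlgebra;
        Module.finrank W.carrier.functionField V.carrier.functionField) := by
  set ξ' := _root_.genericPoint V.carrier with hξ'
  set ξ := _root_.genericPoint W.carrier with hξ
  have hy : π.base (V.ι ξ') = W.ι ξ := V.apply_ι_genericPoint_eq_of_fac π W h fac
  have hspec : h ξ' ⤳ ξ := specializes_genericPoint h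
  letI algW := (functionFieldMap h).toAlgebra
  letI algκ := (π.residueFieldMap (V.ι ξ')).hom.toAlgebra
  -- transport `𝒪_{X, π y'} ≅ 𝒪_{X, W.ι ξ}` along `π y' = W.ι ξ`
  let eγ : X.presheaf.stalk (π.base (V.ι ξ')) ≃+* X.presheaf.stalk (W.ι ξ) :=
    (X.presheaf.stalkCongr (.of_eq hy)).commRingCatIsoToRingEquiv
  change Module.finrank (X.residueField (π.base (V.ι ξ'))) (X'.residueField (V.ι ξ')) = _
  refine Algebra.finrank_eq_of_equiv_equiv ((ResidueField.mapEquiv eγ).trans W.residueFieldEquiv)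
    V.residueFieldEquiv ?_
  -- compatibility of the identifications with `h^♯` and `π^♯`: an identity of maps out of
  -- `𝒪_{X, π y'}`
  have H : (X.presheaf.stalkCongr (.of_eq hy)).hom ≫ W.ι.stalkMap ξ ≫
      W.carrier.presheaf.stalkSpecializes hspec ≫ h.stalkMap ξ' =
        π.stalkMap (V.ι ξ') ≫ V.ι.stalkMap ξ' := by
    rw [← Scheme.Hom.stalkSpecializes_stalkMap_assoc W.ι _ _ hspec, ← Scheme.Hom.stalkMap_comp h W.ι ξ',
      Scheme.Hom.stalkMap_congr_hom _ _ fac ξ', Scheme.Hom.stalkMap_comp V.ι π ξ']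
    simp only [TopCat.Presheaf.stalkCongr_hom, TopCat.Presheaf.stalkSpecializes_comp_assoc]
    erw [TopCat.Presheaf.stalkSpecializes_comp_assoc, TopCat.Presheaf.stalkSpecializes_refl]
    exact Category.id_comp _
  apply Ideal.Quotient.ringHom_ext
  apply RingHom.ext
  intro s
  change functionFieldMap h (W.residueFieldEquiv (ResidueField.mapEquiv eγ (residue _ s))) =
    V.residueFieldEquiv ((π.residueFieldMap (V.ι ξ')).hom (residue _ s))
  have hsq : (π.residueFieldMap (V.ι ξ')).hom (residue _ s) =
      residue _ ((π.stalkMap (V.ι ξ')).hom s) := by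
    change (X.residue _ ≫ π.residueFieldMap (V.ι ξ')) s = _
    rw [Scheme.residue_residueFieldMap]
    rfl
  rw [hsq, residueFieldEquiv_residue, ResidueField.mapEquiv_apply, ResidueField.map_residue,
    residueFieldEquiv_residue]
  change ((X.presheaf.stalkCongr (.of_eq hy)).hom ≫ W.ι.stalkMap ξ ≫
      W.carrier.presheaf.stalkSpecializes hspec ≫ h.stalkMap ξ').hom s =
    (π.stalkMap (V.ι ξ') ≫ V.ι.stalkMap ξ').hom s
  rw [H]

end DegreeFac

/-! ### `[κ(ξ̃) : κ(π ξ̃)] = [R(Ṽ) : R(π(Ṽ))]` -/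

section Degree

variable {X' X : Scheme.{u}} (π : X' ⟶ X) [QuasiCompact π] (V : ClosedSubvariety X')

/-- The image of the generic point of `Ṽ` is the generic point of `π(Ṽ)` (in `X`). [folklore] -/
theorem apply_ι_genericPoint_eq :
    π (V.ι (_root_.genericPoint V.carrier)) = (V.image π).ι (_root_.genericPoint (V.image π).carrier) :=
  V.apply_ι_genericPoint_eq_of_fac π (V.image π) (V.toImage π) (V.toImage_ι π)

/-- **The residue degree of `π` at the generic point of a closed subvariety `Ṽ ⊆ X'` is the degree
`[R(Ṽ) : R(W)]` of the function field extension of `h : Ṽ → W = π(Ṽ)`** (Fulton §1.4: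
`deg(V/W) = [R(V) : R(W)]`; with Mathlib's junk value `0` on both sides in the infinite case).
[cite: Fulton1998, §1.4 (p. 11)] -/
theorem residueDegree_eq_finrank_functionField :
    π.residueDegree (V.ι (_root_.genericPoint V.carrier)) =
      (letI := (functionFieldMap (V.toImage π)).toAlgebra;
        Module.finrank (V.image π).carrier.functionField V.carrier.functionField) :=
  V.residueDegree_eq_finrank_of_fac π (V.image π) (V.toImage π) (V.toImage_ι π)

end Degree

end ClosedSubvariety

end Literature.AlgebraicGeometry.Motives

end
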